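import Literature.Topology.FourManifolds.CappellShanesonTraceClassesProofs
import Literature.Topology.FourManifolds.CappellShanesonIdealClasses
import Literature.Topology.FourManifolds.CappellShanesonGompfConjectureSmallTraces
import HarnessLib

/-!
# The class group of the trace `12` field (discriminant `7537`) and Gompf's conjecture for the
# traces `12` and `-7` (Kim–Yamada 2023, Theorem B: the first trace beyond `[-6, 11]`)

Serves the named fact
`Literature.Topology.FourManifolds.kimYamada2023_nonempty_diffeomorph_sphere_four_of_trace_mem_Icc`
(`CappellShaneson.lean`; M. H. Kim, S. Yamada, *Ideal classes and Cappell–Shaneson homotopy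
4-spheres*, Kyungpook Math. J. 63 (2023) 373–411 = arXiv:1707.03860, Cor. C), which the tree reduces
to Gompf's three topological leaves and Theorem B in matrix form on the traces `[12, 69]`
(`kimYamada2023_nonempty_diffeomorph_sphere_four_of_trace_mem_Icc_of_Icc_twelve`,
`CappellShanesonGompfConjectureSmallTraces.lean`). This file PROVES Theorem B for the trace `12`
— the first induction step of the printed proof beyond Gompf's window: "`12 ≡ 7 (mod 5)`, by
applying Lemma 6.1 for `n = 12`, we can see that Conjecture 2 is true for trace 12" (§6.1) — and
hence for `-7 = 5 - 12` (Theorem A), so that Gompf's conjecture is now proved for every trace in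
`[-7, 12]` (`gompfConjectureForTrace_of_mem_Icc_neg_seven_twelve`) and the named fact is reduced to
the traces `[13, 69]` and the leaves
(`kimYamada2023_nonempty_diffeomorph_sphere_four_of_trace_mem_Icc_of_Icc_thirteen`).

## The number theory (the row `n = 12` of Kim–Yamada's Table 2, proved)

Lemma 6.1 at `n = 12` needs the ideal class monoid `C(ℤ[Θ₁₂])`: its classes are represented by
`(1, 1, 12)` and `(4, 5, 12)`, i.e. every non-zero ideal of `ℤ[Θ₁₂] = ℤ[X]/(f₁₂)`,
`f₁₂ = x³ - 12x² + 11x - 1`, is in the class of `⟨Θ - 1, 1⟩ = ℤ[Θ₁₂]` or of `⟨Θ - 4, 5⟩`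
(`ideal_class_adjoinRoot_twelve`; Kim–Yamada compute the tables with MAGMA, §5). Proof, as in
`CappellShanesonClassNumberTwo.lean` (Marcus, *Number Fields*, Ch. 3, Thm. 27; Ch. 5, after
Thm. 37), for any cubic number field `K` generated by a root `θ` of `f₁₂`:

* `Δ(f₁₂) = 12·10·9·7 - 23 = 7537` is prime, so `𝓞 K = ℤ[θ]`, `d_K = 7537`
  (`discr_eq_csDisc_of_sq`), and `⌊M_K⌋ ≤ 24` (`floor_minkowskiBound_le_cubic`);
* Dedekind–Kummer at `p ≤ 24`: `2, 3, 23` are inert; `f₁₂` has exactly one root modulo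
  `5, 7, 11, 17, 19` (roots `4, 3, 5, 4, 2`), giving the degree-one primes `𝔭₅ = (5, θ - 4)`,
  `𝔭₇ = (7, θ - 3)`, `𝔭₁₁ = (11, θ - 5)`, `𝔭₁₇ = (17, θ - 4)`, `𝔭₁₉ = (19, θ - 2)` as the only primes
  `P` above them with `p ^ {f_P} ≤ 24`; and `f₁₂ ≡ (x - 7)(x - 8)(x - 10) (mod 13)`, so the primes
  above `13` are `𝔭₁₃ = (13, θ - 7)`, `𝔭₁₃' = (13, θ - 8)`, `𝔭₁₃'' = (13, θ - 10)`;
* relations, each certified by explicit cofactors in `ℤ[θ]`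
  (`span_pair_mul_span_pair_eq_span_singleton`, `span_pair_eq_span_singleton`):
  `𝔭₅² = (θ + 1)` (norm `25`), `𝔭₅ 𝔭₇ = (2 - 3θ)` (`35`), `𝔭₁₃ = (1 - 2θ)` (`13`),
  `𝔭₅ 𝔭₁₃' = (3 - 2θ)` (`65`), `𝔭₁₁ 𝔭₁₃'' = (4 - 3θ)` (`143`), `𝔭₇ 𝔭₁₃'' = (θ - 10)` (`91`),
  `𝔭₅ 𝔭₁₇ = (θ - 4)` (`85`), `𝔭₁₉ = (θ - 2)` (`19`);
* hence every ideal class is `1` or `[𝔭₅]`, and `[𝔭₅]² = 1` (`classGroup_mem_pair_twelve`; the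
  class number is `≤ 2` — that it is exactly `2` is not needed and not proved).

Transport to `ℤ[X]/(f₁₂)` (`exists_ringEquiv_adjoinRoot_of_sq`), then Prop. 2.14 in the form of
`CappellShanesonIdealClasses.lean` (`exists_isConj_standardCSMatrix_of_cover`): every
Cappell–Shaneson matrix of trace `12` is similar to `X_{1,1,12} = A₁₀` or to `X_{4,5,12}`
(`isConj_standardCSMatrix_of_trace_eq_twelve`), and `X_{4,5,12} ∼_G X_{4,5,7} ∼ A₀`
(`gompfEquiv_standardCSMatrix_akbulutKirbyMatrix_of_modEq`, trace `7` having class number one):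
`gompfConjectureForTrace_twelve`. No named fact is introduced (D-0026).

## References

* [KimYamada2023] M. H. Kim, S. Yamada, Kyungpook Math. J. 63 (2023) 373–411 (arXiv:1707.03860):
  §2.3 (Prop. 2.14), §5 (Table 2), §6.1 (Lemma 6.1 and the proof of Thm. B, step `n = 12`),
  Thm. A.
* [Marcus2018] D. A. Marcus, *Number Fields*, 2nd ed., Ch. 3, Thm. 27 (Dedekind–Kummer); Ch. 5,
  Cor. 2 of Thm. 37 (Minkowski bound) and the computations following it.
-/

noncomputable section

open Set Polynomial Module NumberField Ideal
open scoped NumberField MatrixGroups nonZeroDivisors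
open Literature.LinearAlgebra.Matrix

namespace Literature.Topology.FourManifolds

section Field

variable {K : Type*} [Field K] [NumberField K] {θ : K}

/-! ### Discriminant `7537` and `𝓞 K = ℤ[θ]` -/

/-- `Δ(f₁₂) = 12·10·9·7 - 23 = 7537`. [cite: KimYamada2023, §3 (Δ(fₙ) = n(n-2)(n-3)(n-5) - 23)] -/
theorem csDisc_twelve : csDisc 12 = 7537 := by
  decide

/-- `7537` is prime; in particular `Δ(f₁₂)` has no factorisation `r² e` with `|e| > 2`, `r ≠ ±1`,
so `𝓞 K = ℤ[θ]` for a cubic field generated by a root `θ` of `f₁₂`. [folklore] -/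
theorem csDisc_twelve_sq : ∀ r e : ℤ, csDisc 12 = r ^ 2 * e → 2 < |e| → IsUnit r :=
  isUnit_of_eq_sq_mul (B := 86) (by decide) (by decide) (by decide)

/-- `d_K = 7537` for the trace `12` field. [folklore] -/
theorem discr_eq_twelve (hθ : aeval θ (csPoly 12) = 0) (h3 : finrank ℚ K = 3) :
    NumberField.discr K = 7537 := by
  rw [discr_eq_csDisc_of_sq hθ h3 csDisc_twelve_sq, csDisc_twelve]

/-- The cubic relation `θ³ - 12θ² + 11θ - 1 = 0` in `𝓞 K`. [folklore] -/
theorem thetaInt_rel_twelve (hθ : aeval θ (csPoly 12) = 0) :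
    (thetaInt hθ) ^ 3 - 12 * (thetaInt hθ) ^ 2 + 11 * thetaInt hθ - 1 = 0 := by
  have rel := thetaInt_rel hθ
  push_cast at rel
  linear_combination rel

/-! ### The primes of norm at most `24` (Dedekind–Kummer) -/

/-- `2` is inert: `f₁₂ ≡ x³ + x + 1 (mod 2)` has no root. [folklore] -/
theorem eq_span_two_twelve (hθ : aeval θ (csPoly 12) = 0) (h3 : finrank ℚ K = 3)
    {P : Ideal (𝓞 K)} (hP : P ∈ primesOver (span {((2 : ℕ) : ℤ)}) (𝓞 K)) :
    P = span {((2 : ℕ) : 𝓞 K)} :=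
  eq_span_of_no_root_of_sq hθ h3 csDisc_twelve_sq Nat.prime_two hP (by decide)

/-- `3` is inert: `f₁₂ ≡ x³ + 2x + 2 (mod 3)` has no root. [folklore] -/
theorem eq_span_three_twelve (hθ : aeval θ (csPoly 12) = 0) (h3 : finrank ℚ K = 3)
    {P : Ideal (𝓞 K)} (hP : P ∈ primesOver (span {((3 : ℕ) : ℤ)}) (𝓞 K)) :
    P = span {((3 : ℕ) : 𝓞 K)} :=
  eq_span_of_no_root_of_sq hθ h3 csDisc_twelve_sq Nat.prime_three hP (by decide)

/-- `23` is inert: `f₁₂` has no root modulo `23`. [folklore] -/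
theorem eq_span_23_twelve (hθ : aeval θ (csPoly 12) = 0) (h3 : finrank ℚ K = 3)
    {P : Ideal (𝓞 K)} (hP : P ∈ primesOver (span {((23 : ℕ) : ℤ)}) (𝓞 K)) :
    P = span {((23 : ℕ) : 𝓞 K)} :=
  eq_span_of_no_root_of_sq hθ h3 csDisc_twelve_sq (by norm_num) hP (by decide)

/-- The prime of degree one above `5` is `𝔭₅ = (5, θ - 4)` (`4` is the only root of `f₁₂` mod `5`,
`f₁₂ ≡ (x - 4)(x² + 2x + 4)`). [folklore] -/
theorem eq_P5_twelve (hθ : aeval θ (csPoly 12) = 0) (h3 : finrank ℚ K = 3)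
    {P : Ideal (𝓞 K)} (hP : P ∈ primesOver (span {((5 : ℕ) : ℤ)}) (𝓞 K))
    (hle : 5 ^ P.inertiaDeg ℤ ≤ 24) :
    P = span {(5 : 𝓞 K), thetaInt hθ - 4} := by
  have h := eq_span_pair_of_unique_root_of_sq hθ h3 csDisc_twelve_sq (by norm_num) hP hle
    (c₀ := 4) (by decide) (by norm_num)
  simpa using h

/-- The prime of degree one above `7` is `𝔭₇ = (7, θ - 3)` (`3` is the only root of `f₁₂` mod `7`,
`f₁₂ ≡ (x - 3)(x² + 5x + 5)`). [folklore] -/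
theorem eq_P7_twelve (hθ : aeval θ (csPoly 12) = 0) (h3 : finrank ℚ K = 3)
    {P : Ideal (𝓞 K)} (hP : P ∈ primesOver (span {((7 : ℕ) : ℤ)}) (𝓞 K))
    (hle : 7 ^ P.inertiaDeg ℤ ≤ 24) :
    P = span {(7 : 𝓞 K), thetaInt hθ - 3} := by
  have h := eq_span_pair_of_unique_root_of_sq hθ h3 csDisc_twelve_sq (by norm_num) hP hle
    (c₀ := 3) (by decide) (by norm_num)
  simpa using h

/-- The prime of degree one above `11` is `𝔭₁₁ = (11, θ - 5)` (`5` is the only root of `f₁₂` mod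
`11`). [folklore] -/
theorem eq_P11_twelve (hθ : aeval θ (csPoly 12) = 0) (h3 : finrank ℚ K = 3)
    {P : Ideal (𝓞 K)} (hP : P ∈ primesOver (span {((11 : ℕ) : ℤ)}) (𝓞 K))
    (hle : 11 ^ P.inertiaDeg ℤ ≤ 24) :
    P = span {(11 : 𝓞 K), thetaInt hθ - 5} := by
  have h := eq_span_pair_of_unique_root_of_sq hθ h3 csDisc_twelve_sq (by norm_num) hP hle
    (c₀ := 5) (by decide) (by norm_num)
  simpa using h

/-- The prime of degree one above `17` is `𝔭₁₇ = (17, θ - 4)` (`4` is the only root of `f₁₂` mod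
`17`). [folklore] -/
theorem eq_P17_twelve (hθ : aeval θ (csPoly 12) = 0) (h3 : finrank ℚ K = 3)
    {P : Ideal (𝓞 K)} (hP : P ∈ primesOver (span {((17 : ℕ) : ℤ)}) (𝓞 K))
    (hle : 17 ^ P.inertiaDeg ℤ ≤ 24) :
    P = span {(17 : 𝓞 K), thetaInt hθ - 4} := by
  have h := eq_span_pair_of_unique_root_of_sq hθ h3 csDisc_twelve_sq (by norm_num) hP hle
    (c₀ := 4) (by decide) (by norm_num)
  simpa using h

/-- The prime of degree one above `19` is `𝔭₁₉ = (19, θ - 2)` (`2` is the only root of `f₁₂` mod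
`19`). [folklore] -/
theorem eq_P19_twelve (hθ : aeval θ (csPoly 12) = 0) (h3 : finrank ℚ K = 3)
    {P : Ideal (𝓞 K)} (hP : P ∈ primesOver (span {((19 : ℕ) : ℤ)}) (𝓞 K))
    (hle : 19 ^ P.inertiaDeg ℤ ≤ 24) :
    P = span {(19 : 𝓞 K), thetaInt hθ - 2} := by
  have h := eq_span_pair_of_unique_root_of_sq hθ h3 csDisc_twelve_sq (by norm_num) hP hle
    (c₀ := 2) (by decide) (by norm_num)
  simpa using h

/-- `f₁₂ = (x - 7)(x - 8)(x - 10) + 13 (x² - 15x + 43)` in `ℤ[x]`, whence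
`f₁₂ ≡ (x - 7)(x - 8)(x - 10) (mod 13)`: `13` splits completely. [folklore] -/
theorem csPoly_twelve_eq :
    csPoly 12 = (X - 7) * (X - 8) * (X - 10) + 13 * (X ^ 2 - 15 * X + 43) := by
  simp only [csPoly, map_sub, map_one, map_ofNat]
  ring

/-- `f₁₂ mod 13 = (x - 7)(x - 8)(x - 10)` in `𝔽₁₃[x]`. [folklore] -/
theorem csPolyMod_twelve_thirteen :
    csPolyMod 12 13 = (X - 7) * (X - 8) * (X - 10) := by
  rw [csPolyMod, csPoly_twelve_eq, Polynomial.map_add]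
  have h13 : Polynomial.map (Int.castRingHom (ZMod 13)) (13 * (X ^ 2 - 15 * X + 43) : ℤ[X]) = 0 := by
    rw [Polynomial.map_mul, show (13 : ℤ[X]) = C 13 from rfl, Polynomial.map_C]
    have : (Int.castRingHom (ZMod 13)) 13 = 0 := by decide
    rw [this, C_0, zero_mul]
  rw [h13, add_zero]
  simp [Polynomial.map_ofNat]

/-- A monic irreducible factor of `(x - 7)(x - 8)(x - 10)` over `𝔽₁₃` is one of the three linear
factors. [folklore] -/
theorem eq_of_dvd_three_linear {Qb : (ZMod 13)[X]} (hirr : Irreducible Qb) (hmon : Qb.Monic)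
    (hdvd : Qb ∣ (X - 7) * (X - 8) * (X - 10)) :
    Qb = X - 7 ∨ Qb = X - 8 ∨ Qb = X - 10 := by
  haveI := Fact.mk (show Nat.Prime 13 by norm_num)
  have hprime : Prime Qb := hirr.prime
  have hdeg1 : 1 ≤ Qb.natDegree := by
    rcases Nat.eq_zero_or_pos Qb.natDegree with h0 | h0
    · exact absurd (Polynomial.eq_one_of_monic_natDegree_zero hmon h0 ▸ isUnit_one) hirr.not_isUnit
    · exact h0
  have key : ∀ q : (ZMod 13)[X], q.Monic → q.natDegree = 1 → Qb ∣ q → Qb = q :=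
    fun q hq hq1 hc => (Polynomial.eq_of_monic_of_dvd_of_natDegree_le hmon hq hc (by omega)).symm
  rcases hprime.dvd_or_dvd hdvd with h78 | h10
  · rcases hprime.dvd_or_dvd h78 with h7 | h8
    · exact Or.inl (key _ (by monicity!) (by compute_degree!) h7)
    · exact Or.inr (Or.inl (key _ (by monicity!) (by compute_degree!) h8))
  · exact Or.inr (Or.inr (key _ (by monicity!) (by compute_degree!) h10))

/-- **The three primes above `13`**: `𝔭₁₃ = (13, θ - 7)`, `𝔭₁₃' = (13, θ - 8)`,
`𝔭₁₃'' = (13, θ - 10)`. [folklore] -/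
theorem eq_P13_twelve (hθ : aeval θ (csPoly 12) = 0) (h3 : finrank ℚ K = 3)
    {P : Ideal (𝓞 K)} (hP : P ∈ primesOver (span {((13 : ℕ) : ℤ)}) (𝓞 K)) :
    P = span {(13 : 𝓞 K), thetaInt hθ - 7} ∨ P = span {(13 : 𝓞 K), thetaInt hθ - 8} ∨
      P = span {(13 : 𝓞 K), thetaInt hθ - 10} := by
  haveI := Fact.mk (show Nat.Prime 13 by norm_num)
  obtain ⟨Qb, hirr, hmon, hdvd, -, hspan⟩ :=
    exists_factor_of_mem_primesOver_of_sq hθ h3 csDisc_twelve_sq (show Nat.Prime 13 by norm_num) hP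
  rw [csPolyMod_twelve_thirteen] at hdvd
  have hlin : ∀ c : ℤ, Qb = X - C (c : ZMod 13) → P = span {(13 : 𝓞 K), thetaInt hθ - (c : 𝓞 K)} := by
    intro c hc
    have hQb' : (X - C c : ℤ[X]).map (Int.castRingHom (ZMod 13)) = Qb := by
      rw [Polynomial.map_sub, map_X, map_C, eq_intCast, hc]
    have hPeq := hspan (X - C c) hQb'
    simp only [map_sub, aeval_X, aeval_C, algebraMap_int_eq, Int.coe_castRingHom] at hPeq
    simpa using hPeq
  rcases eq_of_dvd_three_linear hirr hmon hdvd with h7 | h8 | h10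
  · left
    simpa using hlin 7 (by rw [h7, Int.cast_ofNat, map_ofNat])
  · right; left
    simpa using hlin 8 (by rw [h8, Int.cast_ofNat, map_ofNat])
  · right; right
    simpa using hlin 10 (by rw [h10, Int.cast_ofNat, map_ofNat])

/-! ### Relations among the small primes: explicit generators -/

/-- **`𝔭₅² = (θ + 1)`** (`N(θ + 1) = 25`; `θ ≡ -1 ≡ 4` is the simple root mod `5`): certificate with
`δ = (24 - 13θ + θ², -19 + 13θ - θ², -19 + 13θ - θ², 15 - 12θ + θ²)` and
`θ + 1 = 7·25 + 15·5(θ - 4) + (8 - 2θ)(θ - 4)²`. In particular `[𝔭₅]² = 1`. [folklore] -/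
theorem P5_mul_P5_twelve (hθ : aeval θ (csPoly 12) = 0) :
    span {(5 : 𝓞 K), thetaInt hθ - 4} * span {(5 : 𝓞 K), thetaInt hθ - 4} =
      span {thetaInt hθ + 1} := by
  have rel := thetaInt_rel_twelve hθ
  set t := thetaInt hθ with ht
  exact span_pair_mul_span_pair_eq_span_singleton
    (δ₁ := 24 - 13 * t + t ^ 2) (δ₂ := -19 + 13 * t - t ^ 2)
    (δ₃ := -19 + 13 * t - t ^ 2) (δ₄ := 15 - 12 * t + t ^ 2)
    (u₁ := 7) (u₂ := 15) (u₃ := 0) (u₄ := 8 - 2 * t)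
    (by linear_combination (-1 : 𝓞 K) * rel) (by linear_combination (1 : 𝓞 K) * rel)
    (by linear_combination (1 : 𝓞 K) * rel) (by linear_combination (-1 : 𝓞 K) * rel)
    (by linear_combination (2 : 𝓞 K) * rel)

/-- **`𝔭₅ 𝔭₇ = (2 - 3θ)`** (`N(2 - 3θ) = 35`): `2 - 3θ = -2·5(θ - 3) + 7(θ - 4)`. [folklore] -/
theorem P5_mul_P7_twelve (hθ : aeval θ (csPoly 12) = 0) :
    span {(5 : 𝓞 K), thetaInt hθ - 4} * span {(7 : 𝓞 K), thetaInt hθ - 3} =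
      span {2 - 3 * thetaInt hθ} := by
  have rel := thetaInt_rel_twelve hθ
  set t := thetaInt hθ with ht
  exact span_pair_mul_span_pair_eq_span_singleton
    (δ₁ := 31 - 102 * t + 9 * t ^ 2) (δ₂ := -12 + 34 * t - 3 * t ^ 2)
    (δ₃ := -23 + 68 * t - 6 * t ^ 2) (δ₄ := 9 - 23 * t + 2 * t ^ 2)
    (u₁ := 0) (u₂ := -2) (u₃ := 1) (u₄ := 0)
    (by linear_combination (27 : 𝓞 K) * rel) (by linear_combination (-9 : 𝓞 K) * rel)
    (by linear_combination (-18 : 𝓞 K) * rel) (by linear_combination (6 : 𝓞 K) * rel)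
    (by ring)

/-- **`𝔭₅ 𝔭₁₃' = (3 - 2θ)`** (`N(3 - 2θ) = -65`, `𝔭₁₃' = (13, θ - 8)`):
`3 - 2θ = -65 - 3·5(θ - 8) + 13(θ - 4)`. [folklore] -/
theorem P5_mul_P13b_twelve (hθ : aeval θ (csPoly 12) = 0) :
    span {(5 : 𝓞 K), thetaInt hθ - 4} * span {(13 : 𝓞 K), thetaInt hθ - 8} =
      span {3 - 2 * thetaInt hθ} := by
  have rel := thetaInt_rel_twelve hθ
  set t := thetaInt hθ with ht
  exact span_pair_mul_span_pair_eq_span_singleton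
    (δ₁ := 19 + 42 * t - 4 * t ^ 2) (δ₂ := -12 - 21 * t + 2 * t ^ 2)
    (δ₃ := -16 - 21 * t + 2 * t ^ 2) (δ₄ := 10 + 10 * t - t ^ 2)
    (u₁ := -1) (u₂ := -3) (u₃ := 1) (u₄ := 0)
    (by linear_combination (-8 : 𝓞 K) * rel) (by linear_combination (4 : 𝓞 K) * rel)
    (by linear_combination (4 : 𝓞 K) * rel) (by linear_combination (-2 : 𝓞 K) * rel)
    (by ring)

/-- **`𝔭₁₁ 𝔭₁₃'' = (4 - 3θ)`** (`N(4 - 3θ) = -143`, `𝔭₁₃'' = (13, θ - 10)`):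
`4 - 3θ = 3·143 + 8·11(θ - 10) - 7·13(θ - 5)`. [folklore] -/
theorem P11_mul_P13c_twelve (hθ : aeval θ (csPoly 12) = 0) :
    span {(11 : 𝓞 K), thetaInt hθ - 5} * span {(13 : 𝓞 K), thetaInt hθ - 10} =
      span {4 - 3 * thetaInt hθ} := by
  have rel := thetaInt_rel_twelve hθ
  set t := thetaInt hθ with ht
  exact span_pair_mul_span_pair_eq_span_singleton
    (δ₁ := 29 + 96 * t - 9 * t ^ 2) (δ₂ := -23 - 64 * t + 6 * t ^ 2)
    (δ₃ := -14 - 32 * t + 3 * t ^ 2) (δ₄ := 11 + 21 * t - 2 * t ^ 2)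
    (u₁ := 3) (u₂ := 8) (u₃ := -7) (u₄ := 0)
    (by linear_combination (-27 : 𝓞 K) * rel) (by linear_combination (18 : 𝓞 K) * rel)
    (by linear_combination (9 : 𝓞 K) * rel) (by linear_combination (-6 : 𝓞 K) * rel)
    (by ring)

/-- **`𝔭₇ 𝔭₁₃'' = (θ - 10)`** (`N(θ - 10) = 91`): `θ - 10 = 91 + 2·7(θ - 10) - 13(θ - 3)`. [folklore] -/
theorem P7_mul_P13c_twelve (hθ : aeval θ (csPoly 12) = 0) :
    span {(7 : 𝓞 K), thetaInt hθ - 3} * span {(13 : 𝓞 K), thetaInt hθ - 10} =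
      span {thetaInt hθ - 10} := by
  have rel := thetaInt_rel_twelve hθ
  set t := thetaInt hθ with ht
  exact span_pair_mul_span_pair_eq_span_singleton
    (δ₁ := -9 - 2 * t + t ^ 2) (δ₂ := 7) (δ₃ := 4 - 2 * t + t ^ 2) (δ₄ := t - 3)
    (u₁ := 1) (u₂ := 2) (u₃ := -1) (u₄ := 0)
    (by linear_combination (-1 : 𝓞 K) * rel) (by ring)
    (by linear_combination (-1 : 𝓞 K) * rel) (by ring)
    (by ring)

/-- **`𝔭₅ 𝔭₁₇ = (θ - 4)`** (`N(θ - 4) = 85`): `θ - 4 = 7·5(θ - 4) - 2·17(θ - 4)`. [folklore] -/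
theorem P5_mul_P17_twelve (hθ : aeval θ (csPoly 12) = 0) :
    span {(5 : 𝓞 K), thetaInt hθ - 4} * span {(17 : 𝓞 K), thetaInt hθ - 4} =
      span {thetaInt hθ - 4} := by
  have rel := thetaInt_rel_twelve hθ
  set t := thetaInt hθ with ht
  exact span_pair_mul_span_pair_eq_span_singleton
    (δ₁ := -21 - 8 * t + t ^ 2) (δ₂ := 5) (δ₃ := 17) (δ₄ := t - 4)
    (u₁ := 0) (u₂ := 7) (u₃ := -2) (u₄ := 0)
    (by linear_combination (-1 : 𝓞 K) * rel) (by ring) (by ring) (by ring)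
    (by ring)

/-- **`𝔭₁₃ = (13, θ - 7) = (1 - 2θ)` is principal** (`N(1 - 2θ) = 13`):
`1 - 2θ = -13 - 2(θ - 7)`, `13 = (1 - 2θ)(21 - 46θ + 4θ²)`, `θ - 7 = (1 - 2θ)(-11 + 23θ - 2θ²)`. [folklore] -/
theorem P13a_eq_twelve (hθ : aeval θ (csPoly 12) = 0) :
    span {(13 : 𝓞 K), thetaInt hθ - 7} = span {1 - 2 * thetaInt hθ} := by
  have rel := thetaInt_rel_twelve hθ
  set t := thetaInt hθ with ht
  exact span_pair_eq_span_singleton (u := -1) (v := -2) (δ := 21 - 46 * t + 4 * t ^ 2)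
    (ε := -11 + 23 * t - 2 * t ^ 2)
    (by ring) (by linear_combination (8 : 𝓞 K) * rel) (by linear_combination (-4 : 𝓞 K) * rel)

/-- **`𝔭₁₉ = (19, θ - 2) = (θ - 2)` is principal** (`N(θ - 2) = 19`):
`19 = (θ - 2)(-9 - 10θ + θ²)`. [folklore] -/
theorem P19_eq_twelve (hθ : aeval θ (csPoly 12) = 0) :
    span {(19 : 𝓞 K), thetaInt hθ - 2} = span {thetaInt hθ - 2} := by
  have rel := thetaInt_rel_twelve hθ
  set t := thetaInt hθ with ht
  exact span_pair_eq_span_singleton (u := 0) (v := 1) (δ := -9 - 10 * t + t ^ 2) (ε := 1)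
    (by ring) (by linear_combination (-1 : 𝓞 K) * rel) (by ring)


/-! ### Every ideal class is `1` or `[𝔭₅]` -/

/-- `𝔭₅ = (5, θ - 4)` is a nonzero ideal. [folklore] -/
theorem P5_mem_nonZeroDivisors_twelve (hθ : aeval θ (csPoly 12) = 0) :
    span {(5 : 𝓞 K), thetaInt hθ - 4} ∈ (Ideal (𝓞 K))⁰ := by
  have h := span_pair_natCast_mem_nonZeroDivisors (K := K) (n := 5) (Nat.succ_ne_zero 4)
    (thetaInt hθ - 4)
  simp only [Nat.cast_ofNat] at h
  exact h

/-- **Every ideal class of the trace `12` field is `1` or `[𝔭₅]`, and `[𝔭₅]² = 1`** (so the class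
number is at most `2`). Proof: `d_K = 7537`, `⌊M_K⌋ ≤ 24`; the primes `P` above `p ≤ 24` with
`p ^ {f_P} ≤ 24` are `(2)`, `𝔭₅`, `𝔭₇`, `𝔭₁₁`, the three primes above `13`, `𝔭₁₇`, `𝔭₁₉` (`3`,
`23` are inert), whose classes lie in the subgroup generated by `[𝔭₅]` by the relations `𝔭₅ 𝔭₇ = (2 - 3θ)`,
`𝔭₁₃ = (1 - 2θ)`, `𝔭₅ 𝔭₁₃' = (3 - 2θ)`, `𝔭₇ 𝔭₁₃'' = (θ - 10)`, `𝔭₁₁ 𝔭₁₃'' = (4 - 3θ)`,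
`𝔭₅ 𝔭₁₇ = (θ - 4)`, `𝔭₁₉ = (θ - 2)`; and `𝔭₅² = (θ + 1)`. (Kim–Yamada's Table 2 lists for `n = 12`
the non-trivial representative with `d = 5`: "`12 ≡ 7 (mod 5)`", §6.1.) [cite: KimYamada2023, §6.1 (proof of Thm. B, n = 12)] -/
theorem classGroup_mem_pair_twelve (hθ : aeval θ (csPoly 12) = 0) (h3 : finrank ℚ K = 3)
    (C : ClassGroup (𝓞 K)) :
    C = 1 ∨ C = ClassGroup.mk0 ⟨span {(5 : 𝓞 K), thetaInt hθ - 4}, P5_mem_nonZeroDivisors_twelve hθ⟩ := by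
  classical
  set c5 : ClassGroup (𝓞 K) :=
    ClassGroup.mk0 ⟨span {(5 : 𝓞 K), thetaInt hθ - 4}, P5_mem_nonZeroDivisors_twelve hθ⟩ with hc5
  have rel := thetaInt_rel_twelve hθ
  set t := thetaInt hθ with ht
  -- nonvanishing: an element dividing a nonzero rational integer is nonzero
  have hne : ∀ (x y : 𝓞 K) (n : ℕ), x * y = n → n ≠ 0 → x ≠ 0 := by
    rintro x y n hxy hn rfl
    rw [zero_mul] at hxy
    exact hn (by exact_mod_cast hxy.symm)
  have hne1 : t + 1 ≠ 0 :=
    hne _ (24 - 13 * t + t ^ 2) 25 (by push_cast; linear_combination (1 : 𝓞 K) * rel) (by norm_num)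
  have hne2 : 2 - 3 * t ≠ 0 :=
    hne _ (31 - 102 * t + 9 * t ^ 2) 35 (by push_cast; linear_combination (-27 : 𝓞 K) * rel)
      (by norm_num)
  have hne3 : 3 - 2 * t ≠ 0 :=
    hne _ (19 + 42 * t - 4 * t ^ 2) 65 (by push_cast; linear_combination (8 : 𝓞 K) * rel)
      (by norm_num)
  have hne4 : 4 - 3 * t ≠ 0 :=
    hne _ (29 + 96 * t - 9 * t ^ 2) 143 (by push_cast; linear_combination (27 : 𝓞 K) * rel)
      (by norm_num)
  have hne5 : t - 10 ≠ 0 :=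
    hne _ (-9 - 2 * t + t ^ 2) 91 (by push_cast; linear_combination (1 : 𝓞 K) * rel) (by norm_num)
  have hne6 : t - 4 ≠ 0 :=
    hne _ (-21 - 8 * t + t ^ 2) 85 (by push_cast; linear_combination (1 : 𝓞 K) * rel) (by norm_num)
  -- the order-two relation `[𝔭₅]² = 1`
  have hsq : c5 * c5 = 1 := by
    have h : c5 = c5⁻¹ :=
      ClassGroup.mk0_eq_mk0_inv_iff.mpr ⟨t + 1, hne1, by simpa using P5_mul_P5_twelve hθ⟩
    rwa [eq_inv_iff_mul_eq_one] at h
  -- the subgroup generated by `c5`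
  let H : Subgroup (ClassGroup (𝓞 K)) := Subgroup.zpowers c5
  have hc5H : c5 ∈ H := Subgroup.mem_zpowers c5
  -- `I J = (x)` gives `[I] = [J]⁻¹`
  have hinv : ∀ (P Q : Ideal (𝓞 K)) (hP0 : P ∈ (Ideal (𝓞 K))⁰) (hQ0 : Q ∈ (Ideal (𝓞 K))⁰) (x : 𝓞 K),
      x ≠ 0 → P * Q = span {x} → ClassGroup.mk0 ⟨P, hP0⟩ = (ClassGroup.mk0 ⟨Q, hQ0⟩)⁻¹ := by
    intro P Q hP0 hQ0 x hx hPQ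
    exact ClassGroup.mk0_eq_mk0_inv_iff.mpr ⟨x, hx, by simpa using hPQ⟩
  have hprinc : ∀ (P : Ideal (𝓞 K)) (hP0 : P ∈ (Ideal (𝓞 K))⁰) (x : 𝓞 K), P = span {x} →
      ClassGroup.mk0 ⟨P, hP0⟩ ∈ H := by
    intro P hP0 x hPx
    have : ClassGroup.mk0 ⟨P, hP0⟩ = 1 :=
      (ClassGroup.mk0_eq_one_iff hP0).mpr ⟨⟨x, by rw [hPx, submodule_span_eq]⟩⟩
    rw [this]
    exact H.one_mem
  -- nonzero-ness of the named primes
  have hnz : ∀ (n : ℕ) (hn : n ≠ 0) (x : 𝓞 K), span {(n : 𝓞 K), x} ∈ (Ideal (𝓞 K))⁰ :=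
    fun n hn x => span_pair_natCast_mem_nonZeroDivisors (K := K) hn x
  have hP7 : span {(7 : 𝓞 K), t - 3} ∈ (Ideal (𝓞 K))⁰ := by
    have h := hnz 7 (by norm_num) (t - 3)
    simp only [Nat.cast_ofNat] at h
    exact h
  have hP13c : span {(13 : 𝓞 K), t - 10} ∈ (Ideal (𝓞 K))⁰ := by
    have h := hnz 13 (by norm_num) (t - 10)
    simp only [Nat.cast_ofNat] at h
    exact h
  have hP5 : span {(5 : 𝓞 K), t - 4} ∈ (Ideal (𝓞 K))⁰ := P5_mem_nonZeroDivisors_twelve hθ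
  -- classes of `𝔭₇` and `𝔭₁₃''`
  have h7cls : ClassGroup.mk0 ⟨span {(7 : 𝓞 K), t - 3}, hP7⟩ = c5⁻¹ := by
    refine hinv _ _ hP7 hP5 (2 - 3 * t) hne2 ?_
    rw [mul_comm]
    exact P5_mul_P7_twelve hθ
  have h13ccls : ClassGroup.mk0 ⟨span {(13 : 𝓞 K), t - 10}, hP13c⟩ = c5 := by
    have h := hinv _ _ hP13c hP7 (t - 10) hne5 (by rw [mul_comm]; exact P7_mul_P13c_twelve hθ)
    rw [h, h7cls, inv_inv]
  -- Minkowski: `⌊M_K⌋ ≤ 24` (`(4/π) (2/9) √7537 < 25`; the field is in fact totally real, so that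
  -- `⌊M_K⌋ = 19`, but the cruder bound avoids computing the signature)
  have hd : ((|NumberField.discr K| : ℤ) : ℝ) ≤ (7537 : ℕ) := by
    rw [discr_eq_twelve hθ h3]
    norm_num
  have hfloor := floor_minkowskiBound_le_cubic h3 hd (s := 86.9) (U := 24) (by norm_num)
    (by norm_num) (by norm_num)
  have htop : H = ⊤ := by
    refine classGroup_subgroup_eq_top_of_primesOver H hfloor fun p hp hprime P hP0 hP hle => ?_
    have hpU : p ≤ 24 := (Finset.mem_Icc.mp hp).2
    have h1p : 1 ≤ p := (Finset.mem_Icc.mp hp).1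
    interval_cases p
    · exact absurd hprime (by decide)
    · exact hprinc P hP0 _ (eq_span_two_twelve hθ h3 hP)
    · exact hprinc P hP0 _ (eq_span_three_twelve hθ h3 hP)
    · exact absurd hprime (by decide)
    · have h5 := eq_P5_twelve hθ h3 hP hle
      subst h5
      exact hc5H
    · exact absurd hprime (by decide)
    · have h7 := eq_P7_twelve hθ h3 hP hle
      subst h7
      rw [h7cls]
      exact H.inv_mem hc5H
    · exact absurd hprime (by decide)
    · exact absurd hprime (by decide)
    · exact absurd hprime (by decide)
    · -- `[𝔭₁₁] = [𝔭₁₃'']⁻¹ = c5⁻¹`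
      have h11 := eq_P11_twelve hθ h3 hP hle
      subst h11
      rw [hinv _ _ hP0 hP13c (4 - 3 * t) hne4 (P11_mul_P13c_twelve hθ), h13ccls]
      exact H.inv_mem hc5H
    · exact absurd hprime (by decide)
    · rcases eq_P13_twelve hθ h3 hP with h13 | h13 | h13 <;> subst h13
      · exact hprinc _ hP0 _ (P13a_eq_twelve hθ)
      · rw [hinv _ _ hP0 hP5 (3 - 2 * t) hne3 (by rw [mul_comm]; exact P5_mul_P13b_twelve hθ)]
        exact H.inv_mem hc5H
      · rw [show ClassGroup.mk0 ⟨span {(13 : 𝓞 K), t - 10}, hP0⟩ =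
            ClassGroup.mk0 ⟨span {(13 : 𝓞 K), t - 10}, hP13c⟩ from rfl, h13ccls]
        exact hc5H
    · exact absurd hprime (by decide)
    · exact absurd hprime (by decide)
    · exact absurd hprime (by decide)
    · have h17 := eq_P17_twelve hθ h3 hP hle
      subst h17
      rw [hinv _ _ hP0 hP5 (t - 4) hne6 (by rw [mul_comm]; exact P5_mul_P17_twelve hθ)]
      exact H.inv_mem hc5H
    · exact absurd hprime (by decide)
    · have h19 := eq_P19_twelve hθ h3 hP hle
      subst h19
      exact hprinc _ hP0 _ (P19_eq_twelve hθ)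
    · exact absurd hprime (by decide)
    · exact absurd hprime (by decide)
    · exact absurd hprime (by decide)
    · exact hprinc P hP0 _ (eq_span_23_twelve hθ h3 hP)
    · exact absurd hprime (by decide)
  -- conclusion from `H = ⊤` and `c5² = 1`
  have hC : C ∈ H := by rw [htop]; exact Subgroup.mem_top C
  obtain ⟨k, rfl⟩ := Subgroup.mem_zpowers_iff.mp hC
  have h2 : c5 ^ (2 : ℤ) = 1 := by rw [zpow_two]; exact hsq
  obtain ⟨j, rfl | rfl⟩ := Int.even_or_odd' k
  · left
    rw [zpow_mul, h2, one_zpow]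
  · right
    rw [zpow_add, zpow_mul, h2, one_zpow, one_mul, zpow_one]

end Field

/-! ### The ideal classes of `ℤ[X]/(f₁₂)` and Gompf's conjecture for the traces `12` and `-7` -/

section Matrices

/-- **The ideal classes of `ℤ[Θ₁₂] = ℤ[X]/(f₁₂)`**: every non-zero ideal `J` satisfies
`(x) J = (y) ⟨Θ - 1, 1⟩` (the unit ideal) or `(x) J = (y) ⟨Θ - 4, 5⟩` for some non-zero `x, y`
(transport of `classGroup_mem_pair_twelve` along `ℤ[X]/(f₁₂) ≅ 𝓞 K`, `K = ℚ[x]/(f₁₂)`). In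
Kim–Yamada's terms: the representatives `(1, 1, 12)`, `(4, 5, 12)` cover `C(ℤ[Θ₁₂])`
(Table 2, row `n = 12`). [cite: KimYamada2023, §6.1 (proof of Thm. B, n = 12)] -/
theorem ideal_class_adjoinRoot_twelve (J : Ideal (AdjoinRoot (csPoly 12))) (hJ : J ≠ ⊥) :
    ∃ x y : AdjoinRoot (csPoly 12), x ≠ 0 ∧ y ≠ 0 ∧
      (span {x} * J = span {y} * csIdeal 1 1 12 ∨ span {x} * J = span {y} * csIdeal 4 5 12) := by
  classical
  set θ' := AdjoinRoot.root (csPolyQ 12) with hθ'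
  have hθ : aeval θ' (csPoly 12) = 0 := aeval_root_csPoly 12
  have h3 : finrank ℚ (CSField 12) = 3 := finrank_CSField 12
  obtain ⟨e, he⟩ := exists_ringEquiv_adjoinRoot_of_sq hθ h3 csDisc_twelve_sq
  set I : Ideal (𝓞 (CSField 12)) := J.map e with hI
  have hIJ : I.map (e.symm : 𝓞 (CSField 12) →+* AdjoinRoot (csPoly 12)) = J := by
    rw [hI]
    exact Ideal.map_of_equiv e (I := J)
  have hI0 : I ≠ ⊥ := by
    intro h0
    apply hJ
    rw [← hIJ, h0, Ideal.map_bot]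
  have hImem : I ∈ (Ideal (𝓞 (CSField 12)))⁰ := mem_nonZeroDivisors_iff_ne_zero.mpr hI0
  have hsymm : ∀ x, (e.symm : 𝓞 (CSField 12) →+* AdjoinRoot (csPoly 12)) (e x) = x :=
    fun x => e.symm_apply_apply x
  have hP5 : (span {(5 : 𝓞 (CSField 12)), thetaInt hθ - 4}).map
      (e.symm : 𝓞 (CSField 12) →+* AdjoinRoot (csPoly 12)) = csIdeal 4 5 12 := by
    rw [Ideal.map_span, Set.image_insert_eq, Set.image_singleton, map_sub, ← he, hsymm, map_ofNat,
      map_ofNat, csIdeal, Set.pair_comm]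
    simp
  rcases classGroup_mem_pair_twelve hθ h3 (ClassGroup.mk0 ⟨I, hImem⟩) with h1 | h5
  · -- principal
    obtain ⟨z, hz⟩ := ((ClassGroup.mk0_eq_one_iff hImem).mp h1).principal
    have hz' : I = span {z} := by rw [hz, submodule_span_eq]
    have hz0 : z ≠ 0 := by
      rintro rfl
      apply hI0
      rw [hz', Ideal.span_singleton_eq_bot]
    refine ⟨1, (e.symm : 𝓞 (CSField 12) →+* AdjoinRoot (csPoly 12)) z, one_ne_zero,
      (map_ne_zero_iff _ e.symm.injective).mpr hz0, Or.inl ?_⟩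
    rw [Ideal.span_singleton_one, Ideal.top_mul, csIdeal_one_one, Ideal.mul_top, ← hIJ, hz',
      Ideal.map_span, Set.image_singleton]
  · -- the class of `𝔭₅`
    obtain ⟨x, y, hx, hy, hxy⟩ := ClassGroup.mk0_eq_mk0_iff.mp h5
    refine ⟨(e.symm : 𝓞 (CSField 12) →+* AdjoinRoot (csPoly 12)) x,
      (e.symm : 𝓞 (CSField 12) →+* AdjoinRoot (csPoly 12)) y,
      (map_ne_zero_iff _ e.symm.injective).mpr hx, (map_ne_zero_iff _ e.symm.injective).mpr hy,
      Or.inr ?_⟩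
    have h := congrArg (Ideal.map (e.symm : 𝓞 (CSField 12) →+* AdjoinRoot (csPoly 12))) hxy
    simp only [Ideal.map_mul, Ideal.map_span, Set.image_singleton] at h
    rw [hIJ] at h
    rw [h, ← hP5, Ideal.map_span]

/-- `5 ∣ f₁₂(4) = -85`: `(4, 5, 12) ∈ 𝒞𝒮`. [cite: KimYamada2023, §6.1 (proof of Thm. B, n = 12)] -/
theorem five_dvd_eval_csPoly_twelve_four : (5 : ℤ) ∣ (csPoly 12).eval 4 := by
  rw [eval_csPoly]; norm_num

/-- **Every Cappell–Shaneson matrix of trace `12` is similar to `X_{1,1,12} = A₁₀` or to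
`X_{4,5,12}`** (the matrix form of Kim–Yamada's Table 2, row `n = 12`, via Prop. 2.14). [cite: KimYamada2023, §6.1 (proof of Thm. B, n = 12) and Prop. 2.14] -/
theorem isConj_standardCSMatrix_of_trace_eq_twelve (A : SL(3, ℤ))
    (hdet : ((A : Matrix (Fin 3) (Fin 3) ℤ) - 1).det = 1)
    (htr : Matrix.trace (A : Matrix (Fin 3) (Fin 3) ℤ) = 12) :
    IsConj A (standardCSMatrix 1 1 12 (one_dvd _)) ∨
      IsConj A (standardCSMatrix 4 5 12 five_dvd_eval_csPoly_twelve_four) := by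
  have hcover : ∀ J : Ideal (AdjoinRoot (csPoly 12)), J ≠ ⊥ →
      ∃ (c d : ℤ) (_ : d ∣ (csPoly 12).eval c) (x y : AdjoinRoot (csPoly 12)),
        x ≠ 0 ∧ y ≠ 0 ∧ Ideal.span {x} * J = Ideal.span {y} * csIdeal c d 12 ∧
          ((c = 1 ∧ d = 1) ∨ (c = 4 ∧ d = 5)) := by
    intro J hJ
    obtain ⟨x, y, hx, hy, hxy⟩ := ideal_class_adjoinRoot_twelve J hJ
    rcases hxy with h1 | h5
    · exact ⟨1, 1, one_dvd _, x, y, hx, hy, h1, Or.inl ⟨rfl, rfl⟩⟩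
    · exact ⟨4, 5, five_dvd_eval_csPoly_twelve_four, x, y, hx, hy, h5, Or.inr ⟨rfl, rfl⟩⟩
  obtain ⟨c, d, h, hconj, hcd⟩ := exists_isConj_standardCSMatrix_of_cover _ hcover A hdet htr
  rcases hcd with ⟨rfl, rfl⟩ | ⟨rfl, rfl⟩
  · exact Or.inl hconj
  · exact Or.inr hconj

/-- **Kim–Yamada 2023, Theorem B for the trace `12`, PROVED: every Cappell–Shaneson matrix of trace
`12` is Gompf equivalent to `A₀`.** As printed (§6.1): "`12 ≡ 7 (mod 5)`, by applying Lemma 6.1 for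
`n = 12`, we can see that Conjecture 2 is true for trace 12" — the non-trivial class is represented
by `(4, 5, 12) ∼_G (4, 5, 7)`, and Gompf's conjecture holds for trace `7` (class number one);
the trivial class is `X_{1,1,12} = A₁₀ ∼ A₀` (Rem. 2.22). [cite: KimYamada2023, Thm. B and §6.1 (n = 12)] -/
theorem gompfConjectureForTrace_twelve : GompfConjectureForTrace 12 := by
  intro A hdet htr
  rcases isConj_standardCSMatrix_of_trace_eq_twelve A hdet htr with h1 | h5
  · exact (GompfEquiv.of_isConj h1).trans (gompfEquiv_standardCSMatrix_one_one 10 (one_dvd _))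
  · exact (GompfEquiv.of_isConj h5).trans
      (gompfEquiv_standardCSMatrix_akbulutKirbyMatrix_of_modEq
        (gompfConjectureForTrace_of_mem_Icc (by norm_num)) five_dvd_eval_csPoly_twelve_four
        (show (12 : ℤ) ≡ 7 [ZMOD 5] by decide))

/-- **Theorem B for the trace `-7`** (`= 5 - 12`), by Theorem A
(`gompfConjectureForTrace_of_five_sub`). [cite: KimYamada2023, Thm. A and Thm. B] -/
theorem gompfConjectureForTrace_neg_seven : GompfConjectureForTrace (-7) := by
  have h := gompfConjectureForTrace_of_five_sub gompfConjectureForTrace_twelve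
  norm_num at h
  exact h

/-- **Gompf's conjecture for every trace `-7 ≤ n ≤ 12`, PROVED** (the window `[-6, 11]` of
`CappellShanesonGompfConjectureSmallTraces.lean`, now unconditional since the trace `-5` fact is
discharged (`aitchisonRubinstein1984_traceNegFiveClasses_holds`), and the traces `12`, `-7`). [cite: KimYamada2023, Thm. B (§6.1)] -/
theorem gompfConjectureForTrace_of_mem_Icc_neg_seven_twelve {n : ℤ} (hn : n ∈ Icc (-7 : ℤ) 12) :
    GompfConjectureForTrace n := by
  simp only [mem_Icc] at hn
  by_cases h12 : n = 12
  · subst h12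
    exact gompfConjectureForTrace_twelve
  by_cases h7 : n = -7
  · subst h7
    exact gompfConjectureForTrace_neg_seven
  exact gompfConjectureForTrace_of_mem_Icc_neg_six_eleven
    aitchisonRubinstein1984_traceNegFiveClasses_holds (by simp only [mem_Icc]; omega)

/-- **What remains of Theorem B: the traces `13 ≤ n ≤ 69`.** [cite: KimYamada2023, Thm. B (§6.1)] -/
theorem forall_gompfConjectureForTrace_of_Icc_thirteen
    (hB : ∀ n ∈ Icc (13 : ℤ) 69, GompfConjectureForTrace n) :
    ∀ n ∈ Icc (-64 : ℤ) 69, GompfConjectureForTrace n := by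
  refine forall_gompfConjectureForTrace_of_Icc_twelve
    aitchisonRubinstein1984_traceNegFiveClasses_holds fun n hn => ?_
  simp only [mem_Icc] at hn
  by_cases h13 : 13 ≤ n
  · exact hB n (by simp only [mem_Icc]; omega)
  · exact gompfConjectureForTrace_twelve |> fun h => by
      have : n = 12 := by omega
      subst this
      exact h

universe u in
/-- **The named fact from the traces `[13, 69]` and the three topological leaves** (Kim–Yamada's
Cor. C ⇐ Thm. B on `[13, 69]` + Gompf's leaves; the traces `[-64, 12] ∪ {5 - n : 13 ≤ n ≤ 69}`
being PROVED or transferred by Theorem A). [cite: KimYamada2023, Thm. B and Cor. C (§1.2, §6.1)] -/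
theorem kimYamada2023_nonempty_diffeomorph_sphere_four_of_trace_mem_Icc_of_Icc_thirteen
    (hΔ : gompf2010_deltaMove.{u}) (h43 : gompf2010_akbulutKirby_framings.{0, 0})
    (hAK : akbulutKirby1979_sphere_four)
    (hB : ∀ n ∈ Icc (13 : ℤ) 69, GompfConjectureForTrace n) :
    kimYamada2023_nonempty_diffeomorph_sphere_four_of_trace_mem_Icc.{u} :=
  kimYamada2023_nonempty_diffeomorph_sphere_four_of_trace_mem_Icc_of hΔ h43 hAK
    (forall_gompfConjectureForTrace_of_Icc_thirteen hB)

end Matrices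

end Literature.Topology.FourManifolds

end
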